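import Literature.Analysis.FluidPDE.LeiZhang2011RegularityCase1
import HarnessLib

/-!
# Lei–Zhang 2011, Theorem 1.4, Case 1 — with the swirl step in its uniform (Theorem 1.1) form

Analysis/FluidPDE **proofs file** (theorems only: no definitions, no named facts, no `sorry`),
companion of `LeiZhang2011RegularityCase1` on the discharge path of
`Literature.Analysis.FluidPDE.LeiZhang2011_regularity_bmoStream` (Z. Lei, Q. S. Zhang,
J. Funct. Anal. 261 (2011) = arXiv:1011.5066, Theorem 1.4, proof §4, Case 1, p. 12).

`case1_falseU` is `case1_false` with the **swirl step assumed only for limit solutions whose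
stream functions are bounded in `BMO` uniformly in time** (`sup_t ‖B(t)‖_BMO ≤ K'`), which is
the hypothesis under which Theorem 1.1 of the paper (class `E`, `‖b‖_E = sup_t ‖B‖_BMO +
sup r|b₃|`, (1.2)–(1.3) p. 3) delivers the Hölder continuity of `Γ`; the earlier `case1_false`
assumed the step for streams merely in `BMO` at each time, a stronger assumption. The blow-up
limit does have a uniform bound (`exists_bmoStream_of_tendstoUniformlyOn`: `6 K`), so the proof
is verbatim that of `case1_false`. [cite: LeiZhang2011, Thm. 1.4, proof §4, Case 1 (arXiv p. 12); Thm. 1.1 and (1.2)–(1.3) (p. 3)]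

## References

* Z. Lei, Q. S. Zhang, J. Funct. Anal. 261 (2011) = arXiv:1011.5066: Thm. 1.1, (1.2)–(1.3),
  Thm. 1.4 proof §4 Case 1. [LeiZhang2011]
-/

noncomputable section

open MeasureTheory Set Function Filter Topology TopologicalSpace Metric
open scoped InnerProductSpace RealInnerProductSpace NNReal ENNReal

namespace Literature.Analysis.FluidPDE

open Literature.Analysis.FunctionSpaces SereginSverak2009

/-- **Lei–Zhang 2011, Theorem 1.4, Case 1 (`r_k Q_k` bounded) leads to a contradiction, given
the swirl step in its uniform form** (`case1_false` with `sup_t ‖B(t)‖_BMO ≤ K'` in the step).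
Let `(u, p)` be a classical solution of the unforced Navier–Stokes system
(`ν = 1`) on `(0, T) × ℝ³` with axisymmetric slices, `|Γ| = |r u^θ| ≤ C₁`, and a stream function
with `BMO` slices on `(0, T)` (`HasBMOStreamFunctionOn`). Suppose near-maxima `(t_n, x_n)`,
`M_n = ‖u(t_n, x_n)‖`, are given with `‖u‖ ≤ 2M_n` on `(0, t_n] × ℝ³`, `t_n M_n² ≥ 2`,
`t_n M_n² → ∞`, and **`|x_n'| M_n ≤ D`** (Case 1). Assume the swirl step (Theorem 1.1 of the
paper for the limit class: a continuous bounded weak ancient axisymmetric solution with bounded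
`Γ` and distributional `L^∞_t BMO_x` stream function is swirl free). Then `False`: the rescaled
solutions centred on the axis converge along a subsequence (uniform Lipschitz bounds from the
`BMO` stream function, `lipschitz_up_to_final_time_of_bmoStream`; pointwise Arzelà–Ascoli) to a
bounded weak ancient solution `v` which is axisymmetric with `|Γ| ≤ C₁` and has a distributional
`BMO` stream function at every time (`exists_bmoStream_of_tendstoUniformlyOn`); the swirl step
removes the swirl, `case1_limit_eq_zero_of_hasNoSwirl` gives `v = 0` up to `t = 0`, while
`‖v(0, a)‖ = lim ‖V_n(0, a_n)‖ = 1`. [cite: LeiZhang2011, Thm. 1.4, proof §4, Case 1 (arXiv p. 12)] -/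
theorem case1_falseU {T : ℝ} {u : ℝ → EuclideanSpace ℝ (Fin 3) → EuclideanSpace ℝ (Fin 3)}
    {p : ℝ → EuclideanSpace ℝ (Fin 3) → ℝ}
    (h : IsClassicalNSSolutionOn (Ioo 0 T) 1 0 u p)
    (haxi : ∀ t ∈ Ioo 0 T, IsAxisymmetric (u t))
    {C₁ : ℝ} (hΓ : ∀ t ∈ Ioo 0 T, ∀ x, |swirl (u t) x| ≤ C₁)
    {Bs : ℝ → EuclideanSpace ℝ (Fin 3) → EuclideanSpace ℝ (Fin 3)} {Kb : ℝ≥0}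
    (hBs : HasBMOStreamFunctionOn (Ioo 0 T) u Bs Kb)
    (hstep : ∀ (v : ℝ → EuclideanSpace ℝ (Fin 3) → EuclideanSpace ℝ (Fin 3)) (C : ℝ)
      (K' : ℝ≥0),
      IsBoundedWeakNSSolutionOn (Iio 0) isOpen_Iio 1 v → Continuous (uncurry v) →
      (∀ t < 0, IsAxisymmetric (v t)) → (∀ t < 0, ∀ x, |swirl (v t) x| ≤ C) →
      (∀ t < 0, ∃ Bt : EuclideanSpace ℝ (Fin 3) → EuclideanSpace ℝ (Fin 3),
        LocallyIntegrable Bt volume ∧ eBMOSeminormVec Bt ≤ K' ∧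
        ∀ (φ : EuclideanSpace ℝ (Fin 3) → ℝ) (e : EuclideanSpace ℝ (Fin 3)),
          ContDiff ℝ 1 φ → HasCompactSupport φ →
            ∫ x, φ x * ⟪v t x, e⟫ = ∫ x, ⟪cross (Bt x) (gradient φ x), e⟫) →
      ∀ t < 0, HasNoSwirl (v t))
    {tn : ℕ → ℝ} {xn : ℕ → EuclideanSpace ℝ (Fin 3)} (htn : ∀ n, tn n ∈ Ioo 0 T)
    (hMpos : ∀ n, 0 < ‖u (tn n) (xn n)‖)
    (hmax : ∀ n, ∀ s ∈ Ioc 0 (tn n), ∀ y, ‖u s y‖ ≤ 2 * ‖u (tn n) (xn n)‖)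
    (hA2 : ∀ n, 2 ≤ tn n * ‖u (tn n) (xn n)‖ ^ 2)
    (hAtop : Tendsto (fun n => tn n * ‖u (tn n) (xn n)‖ ^ 2) atTop atTop)
    {D : ℝ} (hD : ∀ n, cylRadius (xn n) * ‖u (tn n) (xn n)‖ ≤ D) : False := by
  -- the uniform Lipschitz constant on unit windows at the bound `2`
  obtain ⟨K, hK0, hKprop⟩ :=
    KNSS2009_regularity_boundedWeak_window_holds.lipschitz_of_bmoStream 2
  set M : ℕ → ℝ := fun n => ‖u (tn n) (xn n)‖ with hMdef
  -- the scaling factors and the time intervals of the rescaled solutions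
  set c : ℕ → ℝ := fun n => (M n)⁻¹ with hcdef
  have hcpos : ∀ n, 0 < c n := fun n => inv_pos.2 (hMpos n)
  have hceq : ∀ n, c n = ‖u (tn n) (xn n)‖⁻¹ := fun n => rfl
  set A : ℕ → ℝ := fun n => -(tn n / c n ^ 2) with hAdef
  set B : ℕ → ℝ := fun n => (T - tn n) / c n ^ 2 with hBdef
  have hAeq : ∀ n, A n = -(tn n * M n ^ 2) := fun n => by
    simp only [hAdef, hcdef, inv_pow, div_inv_eq_mul]
  have hA2' : ∀ n, A n ≤ -2 := fun n => by rw [hAeq]; linarith [hA2 n]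
  have hBpos : ∀ n, 0 < B n := fun n => div_pos (by linarith [(htn n).2]) (pow_pos (hcpos n) 2)
  have hAtend : Tendsto A atTop atBot := by
    have : A = fun n => -(tn n * M n ^ 2) := funext hAeq
    rw [this]
    exact tendsto_neg_atTop_atBot.comp hAtop
  -- the rescaled solutions, centred on the axis
  set V : ℕ → ℝ → EuclideanSpace ℝ (Fin 3) → EuclideanSpace ℝ (Fin 3) :=
    fun n => c n • stPull (c n ^ 2) (c n) (tn n) (xn n 2 • eZ) u with hVdef
  set P : ℕ → ℝ → EuclideanSpace ℝ (Fin 3) → ℝ :=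
    fun n => c n ^ 2 • stPull (c n ^ 2) (c n) (tn n) (xn n 2 • eZ) p with hPdef
  have hVcl : ∀ n, IsClassicalNSSolutionOn (Ioo (A n) (B n)) 1 0 (V n) (P n) := fun n =>
    zoom_isClassicalNSSolutionOn h (hcpos n) (tn n) (xn n)
  have hVbd : ∀ n, ∀ s ∈ Ioc (A n) 0, ∀ y, ‖V n s y‖ ≤ 2 := fun n =>
    zoom_norm_le_two (hmax n) (hMpos n) (hceq n)
  have hVmem : ∀ n, ∀ s ∈ Ioo (A n) (B n), tn n + c n ^ 2 * s ∈ Ioo 0 T := fun n s hs =>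
    zoom_time_mem (hcpos n).ne' hs
  have hVaxi : ∀ n, ∀ s ∈ Ioo (A n) (B n), IsAxisymmetric (V n s) := fun n s hs =>
    zoom_isAxisymmetric haxi (hVmem n s hs)
  have hVswirl : ∀ n, ∀ s ∈ Ioo (A n) (B n), ∀ y, |swirl (V n s) y| ≤ C₁ := fun n s hs y =>
    zoom_abs_swirl_le hΓ (hcpos n).ne' (hVmem n s hs) y
  have hVstream : ∀ n, HasBMOStreamFunctionOn (Ioo (A n) (B n)) (V n)
      (stPull (c n ^ 2) (c n) (tn n) (xn n 2 • eZ) Bs) Kb := fun n =>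
    zoom_hasBMOStreamFunctionOn hBs (hcpos n).ne' (tn n) (xn n)
  set a : ℕ → EuclideanSpace ℝ (Fin 3) := fun n => (c n)⁻¹ • horiz (xn n) with hadef
  have hVone : ∀ n, ‖V n 0 (a n)‖ = 1 := fun n => norm_zoom_apply_zero_offset (hMpos n) (hceq n)
  have hale : ∀ n, ‖a n‖ ≤ D := fun n => by
    rw [hadef]
    show ‖(c n)⁻¹ • horiz (xn n)‖ ≤ D
    rw [norm_inv_smul_horiz (hcpos n), hcdef, inv_inv, mul_comm]
    exact hD n
  have hVcont : ∀ n, ContinuousOn (uncurry (V n)) (Ioo (A n) (B n) ×ˢ univ) := fun n =>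
    (hVcl n).smooth_velocity.continuousOn
  -- uniform Lipschitz bound on `[A n + 1, 0] × ℝ³`, and the clamped maps
  have hLip : ∀ n, ∀ s ∈ Icc (A n + 1) 0, ∀ t ∈ Icc (A n + 1) 0, ∀ x y,
      ‖V n t x - V n s y‖ ≤ max K 8 * (|t - s| + ‖x - y‖) := fun n =>
    lipschitz_up_to_final_time_of_bmoStream hKprop (hA2' n) (hBpos n) (hVcl n) (hVbd n)
      ⟨_, Kb, hVstream n⟩
  set W : ℕ → ℝ × EuclideanSpace ℝ (Fin 3) → EuclideanSpace ℝ (Fin 3) :=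
    fun n z => V n (max (A n + 1) (min z.1 0)) z.2 with hWdef
  have hK8 : 0 ≤ max K 8 := hK0.trans (le_max_left _ _)
  have hK8pos : 0 < max K 8 := lt_of_lt_of_le (by norm_num) (le_max_right _ _)
  have hWlip : ∀ n, LipschitzWith (Real.toNNReal (2 * max K 8)) (W n) := fun n =>
    lipschitzWith_clamp hK8 (by linarith [hA2' n]) (hLip n)
  have hclamp : ∀ n (r : ℝ), max (A n + 1) (min r 0) ∈ Ioc (A n) 0 := fun n r =>
    ⟨by linarith [le_max_left (A n + 1) (min r 0)],
      max_le (by linarith [hA2' n]) (min_le_right _ _)⟩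
  have hWball : ∀ n z, W n z ∈ closedBall (0 : EuclideanSpace ℝ (Fin 3)) 2 := fun n z =>
    mem_closedBall_zero_iff.2 (hVbd n _ (hclamp n z.1) z.2)
  -- extraction: pointwise convergence of the clamped maps, then of the offsets
  obtain ⟨φ, Winf, hφ, hWinflip, -, hWconv⟩ :=
    exists_strictMono_tendsto_of_lipschitzWith W hWlip hWball
  obtain ⟨ainf, -, ψ, hψ, haconv⟩ := tendsto_subseq_of_bounded (x := a ∘ φ)
    (isBounded_closedBall (x := (0 : EuclideanSpace ℝ (Fin 3))) (r := D))
    (fun n => mem_closedBall_zero_iff.2 (hale (φ n)))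
  set θ : ℕ → ℕ := φ ∘ ψ with hθdef
  have hθ : StrictMono θ := hφ.comp hψ
  have hWconvθ : ∀ z, Tendsto (fun m => W (θ m) z) atTop (𝓝 (Winf z)) := fun z =>
    (hWconv z).comp hψ.tendsto_atTop
  have haconvθ : Tendsto (fun m => a (θ m)) atTop (𝓝 ainf) := haconv
  have hAθ : Tendsto (fun m => A (θ m)) atTop atBot := hAtend.comp hθ.tendsto_atTop
  have hevA : ∀ t : ℝ, ∀ᶠ m in atTop, A (θ m) + 1 ≤ t := fun t =>
    (hAθ.eventually (eventually_le_atBot (t - 1))).mono fun m hm => by linarith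
  -- the limit field
  set v : ℝ → EuclideanSpace ℝ (Fin 3) → EuclideanSpace ℝ (Fin 3) := fun t x => Winf (t, x)
    with hvdef
  have hvcont : Continuous (uncurry v) := hWinflip.continuous
  have hVlim : ∀ t ≤ 0, ∀ x, Tendsto (fun m => V (θ m) t x) atTop (𝓝 (v t x)) := by
    intro t ht x
    refine (hWconvθ (t, x)).congr' ((hevA t).mono fun m hm => ?_)
    show V (θ m) (max (A (θ m) + 1) (min t 0)) x = V (θ m) t x
    rw [min_eq_left ht, max_eq_right hm]
  have hevmem : ∀ t < 0, ∀ᶠ m in atTop, t ∈ Ioo (A (θ m)) (B (θ m)) := fun t ht =>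
    (hevA t).mono fun m hm => ⟨by linarith, ht.trans (hBpos _)⟩
  -- the limit is a bounded weak solution on `(-∞, 0)`
  have hweak : IsBoundedWeakNSSolutionOn (Iio 0) isOpen_Iio 1 v := by
    refine isBoundedWeakNSSolutionOn_of_tendsto (A := fun m => A (θ m)) (V := fun m => V (θ m))
      (M := 2) hAθ (fun m => ?_) (fun m => ?_) (fun m s hs y => hVbd (θ m) s ⟨hs.1, hs.2.le⟩ y)
      hvcont (fun t ht x => hVlim t ht.le x)
    · have hcl : IsClassicalNSSolutionOn (Ioo (A (θ m)) 0) 1 0 (V (θ m)) (P (θ m)) :=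
        (hVcl (θ m)).mono (Ioo_subset_Ioo_right (hBpos _).le) (uniqueDiffOn_Ioo _ _)
      exact hcl.isBoundedWeakNSSolutionOn ⟨2, fun s hs y => hVbd (θ m) s ⟨hs.1, hs.2.le⟩ y⟩
    · exact (hVcont (θ m)).mono (prod_mono (Ioo_subset_Ioo_right (hBpos _).le) Subset.rfl)
  -- axisymmetry and the swirl bound pass to the limit
  have hvaxi : ∀ t < 0, IsAxisymmetric (v t) := by
    intro t ht θ' y
    have h1 : Tendsto (fun m => V (θ m) t (rotZ θ' y)) atTop (𝓝 (v t (rotZ θ' y))) :=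
      hVlim t ht.le _
    have h2 : Tendsto (fun m => rotZ θ' (V (θ m) t y)) atTop (𝓝 (rotZ θ' (v t y))) :=
      ((rotZL θ').continuous.tendsto _).comp (hVlim t ht.le y)
    have heq : (fun m => rotZ θ' (V (θ m) t y)) =ᶠ[atTop] fun m => V (θ m) t (rotZ θ' y) :=
      (hevmem t ht).mono fun m hm => (hVaxi (θ m) t hm θ' y).symm
    exact tendsto_nhds_unique h1 (h2.congr' heq)
  have hvswirl : ∀ t < 0, ∀ y, |swirl (v t) y| ≤ C₁ := by
    intro t ht y
    have hsw : Tendsto (fun m => swirl (V (θ m) t) y) atTop (𝓝 (swirl (v t) y)) := by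
      have h0 : Tendsto (fun m => V (θ m) t y 0) atTop (𝓝 (v t y 0)) :=
        ((PiLp.continuous_apply 2 _ 0).tendsto _).comp (hVlim t ht.le y)
      have h1 : Tendsto (fun m => V (θ m) t y 1) atTop (𝓝 (v t y 1)) :=
        ((PiLp.continuous_apply 2 _ 1).tendsto _).comp (hVlim t ht.le y)
      exact (h1.const_mul (y 0)).sub (h0.const_mul (y 1))
    exact le_of_tendsto hsw.abs ((hevmem t ht).mono fun m hm => hVswirl (θ m) t hm y)
  -- the limit has a distributional `BMO` stream function at every `t < 0`
  have hvstream : ∀ t < 0, ∃ Bt : EuclideanSpace ℝ (Fin 3) → EuclideanSpace ℝ (Fin 3),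
      LocallyIntegrable Bt volume ∧ eBMOSeminormVec Bt ≤ ((6 * Kb : ℝ≥0) : ℝ≥0∞) ∧
      ∀ (φ' : EuclideanSpace ℝ (Fin 3) → ℝ) (e : EuclideanSpace ℝ (Fin 3)),
        ContDiff ℝ 1 φ' → HasCompactSupport φ' →
          ∫ x, φ' x * ⟪v t x, e⟫ = ∫ x, ⟪cross (Bt x) (gradient φ' x), e⟫ := by
    intro t ht
    obtain ⟨k₀, hk₀⟩ := eventually_atTop.1 ((hevmem t ht).and (hevA t))
    -- the shifted sequence
    set w : ℕ → EuclideanSpace ℝ (Fin 3) → EuclideanSpace ℝ (Fin 3) :=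
      fun k => V (θ (k + k₀)) t with hw
    set Bk : ℕ → EuclideanSpace ℝ (Fin 3) → EuclideanSpace ℝ (Fin 3) :=
      fun k => stPull (c (θ (k + k₀)) ^ 2) (c (θ (k + k₀))) (tn (θ (k + k₀)))
        (xn (θ (k + k₀)) 2 • eZ) Bs t with hBk
    have hmem : ∀ k, t ∈ Ioo (A (θ (k + k₀))) (B (θ (k + k₀))) := fun k =>
      (hk₀ (k + k₀) (by omega)).1
    have hAk : ∀ k, A (θ (k + k₀)) + 1 ≤ t := fun k => (hk₀ (k + k₀) (by omega)).2
    have hstr : ∀ k, Differentiable ℝ (Bk k) ∧ curl (Bk k) =ᵐ[volume] w k ∧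
        eBMOSeminormVec (Bk k) ≤ Kb := fun k => hVstream (θ (k + k₀)) t (hmem k)
    have hwc : ∀ k, Continuous (w k) := fun k =>
      (hVcont (θ (k + k₀))).comp_continuous (Continuous.prodMk_right t)
        fun x => ⟨hmem k, mem_univ x⟩
    have hconvpt : ∀ x, Tendsto (fun k => w k x) atTop (𝓝 (v t x)) := fun x =>
      (hVlim t ht.le x).comp (tendsto_add_atTop_nat k₀)
    have hlipx : ∀ k x y, ‖w k x - w k y‖ ≤ max K 8 * ‖x - y‖ := fun k x y => by
      have := hLip (θ (k + k₀)) t ⟨hAk k, ht.le⟩ t ⟨hAk k, ht.le⟩ x y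
      simpa using this
    have hunif := (tendstoLocallyUniformly_of_lipschitz_of_tendsto hK8pos hlipx hconvpt).2
    obtain ⟨Bu, hBui, hBubmo, hid⟩ := exists_bmoStream_of_tendstoUniformlyOn
      (fun k => (hstr k).1) (fun k => (hstr k).2.1) (fun k => (hstr k).2.2)
      (fun k => (hwc k).locallyIntegrable)
      ((hvcont.comp (Continuous.prodMk_right t)).locallyIntegrable) (fun r _ => hunif r)
    exact ⟨Bu, hBui, hBubmo.trans_eq (by push_cast; rfl), hid⟩
  -- the swirl step, and Case 1 for the limit
  have hnoswirl := hstep v C₁ (6 * Kb) hweak hvcont hvaxi hvswirl hvstream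
  have hvstream' : ∀ t < 0, ∃ Bt : EuclideanSpace ℝ (Fin 3) → EuclideanSpace ℝ (Fin 3),
      LocallyIntegrable Bt volume ∧ eBMOSeminormVec Bt < ∞ ∧
      ∀ (φ' : EuclideanSpace ℝ (Fin 3) → ℝ) (e : EuclideanSpace ℝ (Fin 3)),
        ContDiff ℝ 1 φ' → HasCompactSupport φ' →
          ∫ x, φ' x * ⟪v t x, e⟫ = ∫ x, ⟪cross (Bt x) (gradient φ' x), e⟫ := fun t ht =>
    (hvstream t ht).imp fun Bt h => ⟨h.1, h.2.1.trans_lt ENNReal.coe_lt_top, h.2.2⟩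
  have hv0 := case1_limit_eq_zero_of_hasNoSwirl hweak hvcont hvaxi hnoswirl hvstream'
  -- but `‖v(0, a)‖ = lim ‖V_n(0, a_n)‖ = 1`
  have hWa : Tendsto (fun m => W (θ m) (0, a (θ m))) atTop (𝓝 (Winf (0, ainf))) := by
    rw [tendsto_iff_dist_tendsto_zero]
    have h1 : ∀ m, dist (W (θ m) (0, a (θ m))) (Winf (0, ainf)) ≤
        2 * max K 8 * dist (a (θ m)) ainf + dist (W (θ m) (0, ainf)) (Winf (0, ainf)) := by
      intro m
      have hd : dist (W (θ m) (0, a (θ m))) (W (θ m) (0, ainf)) ≤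
          2 * max K 8 * dist (a (θ m)) ainf := by
        have := (hWlip (θ m)).dist_le_mul ((0 : ℝ), a (θ m)) ((0 : ℝ), ainf)
        rw [Real.coe_toNNReal _ (by positivity), Prod.dist_eq, dist_self,
          max_eq_right dist_nonneg] at this
        exact this
      linarith [dist_triangle (W (θ m) (0, a (θ m))) (W (θ m) (0, ainf)) (Winf (0, ainf))]
    have h2 : Tendsto (fun m => 2 * max K 8 * dist (a (θ m)) ainf +
        dist (W (θ m) (0, ainf)) (Winf (0, ainf))) atTop (𝓝 0) := by
      have t1 := (tendsto_iff_dist_tendsto_zero.1 haconvθ).const_mul (2 * max K 8)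
      have t2 := tendsto_iff_dist_tendsto_zero.1 (hWconvθ (0, ainf))
      simpa using t1.add t2
    exact squeeze_zero (fun m => dist_nonneg) h1 h2
  have hnorm1 : ‖Winf (0, ainf)‖ = 1 := by
    have h1 : Tendsto (fun m => ‖W (θ m) (0, a (θ m))‖) atTop (𝓝 ‖Winf (0, ainf)‖) := hWa.norm
    have h2 : ∀ m, ‖W (θ m) (0, a (θ m))‖ = 1 := fun m => by
      show ‖V (θ m) (max (A (θ m) + 1) (min 0 0)) (a (θ m))‖ = 1
      rw [min_self, max_eq_right (by linarith [hA2' (θ m)])]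
      exact hVone (θ m)
    refine tendsto_nhds_unique h1 ?_
    simp_rw [h2]
    exact tendsto_const_nhds
  have hv0' : Winf (0, ainf) = 0 := hv0 0 le_rfl ainf
  rw [hv0', norm_zero] at hnorm1
  exact zero_ne_one hnorm1

end Literature.Analysis.FluidPDE
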